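import Summits.Ventures.PercRepro.RankLevelSetTightLayer

/-!
# PercRepro — [WORKAROUND COPY, (um)(35)(2)–(4): the primed (`_S`) re-statement of RankLevelSetAvgSupply, whose landed copy (the citation of record) has no olean yet; every declaration carries the `_S` suffix; imports only modules WITH oleans]
# THE SUPPLY SETS OF PART 2 OF THE AVERAGED CHARGING (night-1, gen 9 session 4; dossier §19.12 (d))

For a member `A` of `U(p,q)` on the tight layer, `F := cl(E ∖ A)`, `K := F ∖ (E ∖ A) ⊆ A`: every set
`T = (E ∖ A) ∪ S₁ ∪ S₂` with `∅ ≠ S₁ ⊆ K`, `∅ ≠ S₂ ⊆ A ∖ F`, `|S₂| ≤ p − q − 1` is DEPENDENT with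
`q + 1 ≤ r(T) ≤ q + |S₂| ≤ p − 1` — so it is a supply set of the averaged identity (`supply_set_spec_S`), of weight
`n − |T|` (and `n` when `|S₂| = 1`, where `r(T) = q + 1`: `supply_set_eRk_of_singleton_S`).

Axioms: standard.
-/
open scoped Matroid

namespace PercRepro

open Set

variable {α : Type} (M : Matroid α) [M.Finite]

/-- The supply sets of part 2: dependent, of rank in `[q + 1, q + |S₂|]`. -/
theorem supply_set_spec_S {p q : ℕ} (hE : M.E.ncard = p + q) {A : Set α} (hA : A ∈ Uset M p q)
    {S₁ S₂ : Set α} (hS₁ : S₁ ⊆ M.closure (M.E \ A) \ (M.E \ A)) (hS₁ne : S₁.Nonempty)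
    (hS₂ : S₂ ⊆ A \ M.closure (M.E \ A)) (hS₂ne : S₂.Nonempty) :
    ¬ M.Indep ((M.E \ A) ∪ S₁ ∪ S₂) ∧
      ((q + 1 : ℕ) : ℕ∞) ≤ M.eRk ((M.E \ A) ∪ S₁ ∪ S₂) ∧
      M.eRk ((M.E \ A) ∪ S₁ ∪ S₂) ≤ (q : ℕ∞) + S₂.encard := by
  have hEfin : M.E.Finite := M.set_finite M.E
  set F := M.closure (M.E \ A) with hF
  have hAE : A ⊆ M.E := hA.1
  have hrAc : M.eRk (M.E \ A) = (q : ℕ∞) := hA.2.2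
  have hFE : F ⊆ M.E := M.closure_subset_ground _
  have hrF : M.eRk F = (q : ℕ∞) := by rw [hF, M.eRk_closure_eq, hrAc]
  have hsubF : M.E \ A ⊆ F := M.subset_closure _ sdiff_subset
  have hS₁F : S₁ ⊆ F := hS₁.trans sdiff_subset
  refine ⟨?_, ?_, ?_⟩
  · -- `(E ∖ A) ∪ S₁ ⊆ F` has rank `≤ q` but more than `q` elements
    intro hind
    have hind' : M.Indep ((M.E \ A) ∪ S₁) := hind.subset subset_union_left
    have h1 : M.eRk ((M.E \ A) ∪ S₁) ≤ (q : ℕ∞) := by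
      rw [← hrF]
      exact M.eRk_mono (union_subset hsubF hS₁F)
    rw [hind'.eRk_eq_encard] at h1
    -- but `|E ∖ A| = q` and `S₁` is a nonempty set disjoint from `E ∖ A`
    have hdisj : Disjoint (M.E \ A) S₁ := by
      rw [Set.disjoint_left]
      intro x hx hxS
      exact (hS₁ hxS).2 hx
    rw [encard_union_eq hdisj] at h1
    have hAc_fin : (M.E \ A).Finite := hEfin.subset sdiff_subset
    have hAc_card : (M.E \ A).encard = (q : ℕ∞) := by
      have hg := Uset_subset_goodImg M hE hA
      obtain ⟨hgi, -⟩ := hg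
      rw [mem_indImg_iff] at hgi
      obtain ⟨-, -, hcard⟩ := hgi
      have hsum := ncard_sdiff_add_ncard_of_subset hAE hEfin
      have hAfin : A.Finite := hEfin.subset hAE
      have hAcard : A.ncard = p := by
        rw [← hAfin.cast_ncard_eq] at hcard
        exact_mod_cast hcard
      rw [← hAc_fin.cast_ncard_eq]
      have : (M.E \ A).ncard = q := by omega
      rw [this]
    rw [hAc_card] at h1
    have h1le : (1 : ℕ∞) ≤ S₁.encard := Set.one_le_encard_iff_nonempty.2 hS₁ne
    have : (q : ℕ∞) < (q : ℕ∞) + S₁.encard :=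
      lt_of_lt_of_le ((ENat.lt_add_one_iff (ENat.coe_ne_top q)).2 le_rfl) (add_le_add_right h1le _)
    exact absurd h1 (not_le.2 this)
  · -- `T ⊇ insert t (E ∖ A)` with `t ∉ F`
    obtain ⟨t, ht⟩ := hS₂ne
    have htF : t ∈ M.E \ M.closure (M.E \ A) := ⟨hAE (hS₂ ht).1, (hS₂ ht).2⟩
    have h1 : M.eRk (insert t (M.E \ A)) = (q : ℕ∞) + 1 := by
      rw [M.eRk_insert_eq_add_one htF, hrAc]
    have h2 : insert t (M.E \ A) ⊆ (M.E \ A) ∪ S₁ ∪ S₂ := by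
      intro x hx
      rcases hx with rfl | hx
      · exact Or.inr ht
      · exact Or.inl (Or.inl hx)
    have h3 := M.eRk_mono h2
    rw [h1] at h3
    exact_mod_cast h3
  · -- `T ⊆ F ∪ S₂`
    have h1 : (M.E \ A) ∪ S₁ ∪ S₂ ⊆ F ∪ S₂ :=
      union_subset_union_left _ (union_subset hsubF hS₁F)
    calc M.eRk ((M.E \ A) ∪ S₁ ∪ S₂) ≤ M.eRk (F ∪ S₂) := M.eRk_mono h1
      _ ≤ M.eRk F + S₂.encard := M.eRk_union_le_eRk_add_encard F S₂
      _ = (q : ℕ∞) + S₂.encard := by rw [hrF]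

/-- With `|S₂| = 1` the supply set has rank exactly `q + 1`. -/
theorem supply_set_eRk_of_singleton_S {p q : ℕ} (hE : M.E.ncard = p + q) {A : Set α} (hA : A ∈ Uset M p q)
    {S₁ : Set α} (hS₁ : S₁ ⊆ M.closure (M.E \ A) \ (M.E \ A)) (hS₁ne : S₁.Nonempty)
    {t : α} (ht : t ∈ A \ M.closure (M.E \ A)) :
    M.eRk ((M.E \ A) ∪ S₁ ∪ {t}) = ((q + 1 : ℕ) : ℕ∞) := by
  obtain ⟨-, h1, h2⟩ := supply_set_spec_S M hE hA hS₁ hS₁ne (S₂ := {t}) (singleton_subset_iff.2 ht)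
    (singleton_nonempty t)
  rw [encard_singleton] at h2
  exact le_antisymm (by exact_mod_cast h2) h1

end PercRepro
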